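import Summits.NavierStokesRegularity.NavierStokesRegularity.Theses.AxisymmetricExtremality
import Summits.NavierStokesRegularity.NavierStokesRegularity.Theorems.AxisymmetricExtremalityAxisymmetricKatoGlobalStubSereginLogSwirlOriginFirstSingular
import Summits.NavierStokesRegularity.NavierStokesRegularity.Theorems.AxisymmetricExtremalityAxisymmetricKatoGlobalStubSereginLogSwirlOriginCleanSlabRepr
import Literature.Analysis.FluidPDE.Seregin2022LogSwirlCriterion
import HarnessLib

/-!
# Seregin 2022, §2: reduction of the local regularity criterion to its classical core by the
# first-singular-time argument —
# crux stmt-NavierStokesRegularity-15453 (`AxisymmetricExtremality.AxisymmetricKatoGlobal`), line registered, support for stub `stub_sereginLogSwirlOrigin`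

Support file (`--supports stmt-NavierStokesRegularity-15453`; theorems only, everything proved)
toward the registered stub `stub_sereginLogSwirlOrigin` = the named fact
`Literature.Analysis.FluidPDE.seregin2022_logSwirl_regularAtOrigin` (G. Seregin, J. Math. Fluid
Mech. 24 (2022), Paper 27 = arXiv:2201.00153, §2: Def. 1.1 in `Q = 𝒞 × ]-1, 0[` + axial
symmetry + the swirl bound (2.2) `|σ| ≤ C₁/ln³(e/|x'|)` ⇒ the origin is a regular point).

The printed proof fixes in Step 1 (arXiv p. 5) a cut-off `η = φ(r)ψ(x₃)ξ(t)` adapted to the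
partial regularity of `v` (`v` smooth on `supp ∇η`: off the axis, on a singularity-free slab in
time, and near two regular axis points `(0, ±h, 0)` of the top slice), and then runs the energy
estimates of Step 3 for `Φ = ω_r/r`, `Γ = ω_θ/r` "multiplied by `Φη⁶`, `Γη⁶` and integrated over
`𝒞`" up to the top time. That integration by parts needs `v` smooth on `supp η` at the times
considered, i.e. it is legitimate only up to the FIRST SINGULAR TIME inside `supp η`; the honest
form of Steps 1–4 is therefore: *if the origin were singular, take a backward-singular axis point
`ẑ = (t̂, x̂)` of least time in a compact box near the origin (the singular set is closed, on the
axis and `𝒫¹`-null); below `t̂` and on `supp ∇η` up to `t̂` the solution is smooth, the key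
estimate of Step 3 holds on `]t̂ - R², t̂[` with constants that stay bounded up to `t̂`, Step 4
gives `C(ρ; ẑ) → 0`, and the ε-regularity criterion makes `ẑ` regular — a contradiction.*

This file proves that reduction for the exact hypothesis block (H) of the fact:

* `seregin2022_regularAtOrigin_of_forall_clean` (registered sub-goal) — **(H) and the classical
  core imply `IsRegularAtOrigin v`.** The core `hcore` is the fully written-out hypothesis: for
  every axis point `ẑ = (t̂, x̂)` with `-1/16 < t̂ ≤ 0`, `|x̂₃| ≤ 1/4`, every scale
  `0 < R ≤ 1/4`, heights `h₋ < x̂₃ < h₊` and width `δ > 0` (`x̂₃ - R ≤ h₋ - δ`,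
  `h₋ + δ < x̂₃ < h₊ - δ`, `h₊ + δ ≤ x̂₃ + R`) such that (C1) every point of the closed
  coordinate cylinder `{|x'| ≤ R, |x₃ - x̂₃| ≤ R}` at the times `t̂ - R² ≤ t < t̂` is a regular
  point of `v` and (C2) at the top time `t̂` every point of that cylinder off the axis or of
  height within `δ` of `h₊` or `h₋` is backward regular, the point `ẑ` is backward regular
  (`v ∈ L_∞(Q(ẑ, r))` for some `r > 0`). (C1)–(C2) are exactly the smoothness that Step 1
  provides for the cut-off `η = φ(r)ψ(x₃)ξ(t)` at `(ẑ, R)` (`ψ' ≠ 0` only in the two strips,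
  `φ' ≠ 0` only off the axis, `ξ' ≠ 0` only strictly below `t̂`), so `hcore` is what Steps 2–4
  prove (in this namespace: Lemma 2.1 `…Lemma21Local*`, `…CFZBounds`, the Step-3 key estimate
  `cutoff_energy_keyEstimate_of_lemma21`, Step 4 `…Step4AssemblyPoloidal`, `…VThetaPassage`,
  and the endgame `isRegularAtOrigin_of_tendsto_cubicC`).
  Proof: `exists_firstSingular_configuration` (sibling `…FirstSingular`) + `hcore`.
* `seregin2022_regularAtOrigin_of_forall_cleanRepr` (registered sub-goal) — the same with the
  core in CLASSICAL form `hcoreV`: for `ẑ, R, h±, δ` as above and a representative `V` of `v` on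
  the slab `Q(ẑ, R) = 𝒞(x̂, R) × ]t̂ - R², t̂[` with `(V, q)` a sufficiently smooth axially
  symmetric solution there (Seregin–Zajaczkowski class: suitable, axisymmetric, slices `C^∞`,
  spatial derivatives locally Hölder) whose spatial derivatives of every order are bounded up
  to the top time near each top-slice point off the axis or in the two strips, `ẑ` is backward
  regular. Proof: the primitive form + `exists_cleanSlab_repr` (sibling `…CleanSlabRepr`).
* `isRegularAtOrigin_iff_backwardRegular_zero` — Seregin–Šverák's "regular origin"
  (`v ∈ L_∞(𝒞(r) × ]-r², 0[)`) is backward regularity of `(0, 0)` in ball cylinders.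
* `seregin2022_logSwirl_regularAtOrigin_of_cleanCore`, `…_of_cleanRepr` — the same reductions
  with the core quantified over the class: the named fact follows from the classical core.

## References

* G. Seregin, J. Math. Fluid Mech. 24 (2022), Paper No. 27 = arXiv:2201.00153, §2 Steps 1–4
  (arXiv pp. 5–7), Def. 1.1, Thm. 1.2. [`Seregin2022LocalAxisym`]
* G. Seregin, V. Šverák, Comm. PDE 34 (2009) = arXiv:0804.1803, §3 (regular points).
  [`SereginSverak2009`]
-/

-- the problem directory repeats the summit name (D-0017); core's `dupNamespace` linter fires
set_option linter.dupNamespace false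

noncomputable section

open MeasureTheory Set Function Filter Topology TopologicalSpace Metric
open scoped NNReal ENNReal

namespace Summit.NavierStokesRegularity.NavierStokesRegularity.Theorems.AxisymmetricKatoGlobal.EulerScaling

open Literature.Analysis.FluidPDE Literature.Analysis.FluidPDE.SereginSverak2009
  Literature.Analysis.FluidPDE.SereginZajaczkowski2007

/-! ### Regular origin and backward regularity of `(0, 0)` -/

/-- **Seregin–Šverák's regularity of the origin is backward regularity of `(0, 0)`**:
`v ∈ L_∞(Q(0, r))` for some `r > 0` (coordinate cylinders `𝒞(r) × ]-r², 0[`) iff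
`v ∈ L_∞(Q_r(0, 0))` for some `r > 0` (ball cylinders), by `Q_r ⊆ Q(0, r)` and
`Q(0, r/2) ⊆ Q_{r/√2} ⊆ Q_r`. [cite: SereginSverak2009, §3 (definition of regular point, arXiv p. 9)] -/
theorem isRegularAtOrigin_iff_backwardRegular_zero
    {v : ℝ → EuclideanSpace ℝ (Fin 3) → EuclideanSpace ℝ (Fin 3)} :
    IsRegularAtOrigin v ↔ ∃ r > 0, eLpNorm (uncurry v) ∞
      (volume.restrict (parabolicCylinder r (0 : ℝ × EuclideanSpace ℝ (Fin 3)))) < ∞ := by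
  constructor
  · rintro ⟨r, hr, hfin⟩
    exact ⟨r, hr, (eLpNorm_mono_measure _ (Measure.restrict_mono
      (parabolicCylinder_subset_parCyl 0 r) le_rfl)).trans_lt hfin⟩
  · rintro ⟨r, hr, hfin⟩
    refine ⟨r / 2, by positivity,
      (eLpNorm_mono_measure _ (Measure.restrict_mono ?_ le_rfl)).trans_lt hfin⟩
    refine (parCyl_subset_parabolicCylinder 0 (by positivity : (0 : ℝ) ≤ r / 2)).trans
      (parabolicCylinder_mono (by positivity) ?_ 0)
    have h2 : Real.sqrt 2 ≤ 2 := by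
      have h := Real.sqrt_le_sqrt (show (2 : ℝ) ≤ 2 ^ 2 by norm_num)
      rwa [Real.sqrt_sq (by norm_num : (0 : ℝ) ≤ 2)] at h
    nlinarith

/-! ### The reduction -/

/-- **Seregin 2022, §2: the local regularity criterion reduced to its classical core by the
first-singular-time argument.** Let `(v, q)` satisfy the hypotheses (H) of the fact
`seregin2022_logSwirl_regularAtOrigin` (Def. 1.1 in `Q = 𝒞 × ]-1, 0[` with the global classes,
axisymmetric slices `v t`, `q t`, and the swirl bound (2.2)). Assume the CORE `hcore`: whenever
`ẑ = (t̂, x̂)` is an axis point with `-1/16 < t̂ ≤ 0`, `|x̂₃| ≤ 1/4`, `0 < R ≤ 1/4`, `h₊, h₋, δ`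
are heights and a width with `x̂₃ - R ≤ h₋ - δ`, `h₋ + δ < x̂₃ < h₊ - δ`, `h₊ + δ ≤ x̂₃ + R`,
such that (C1) every `(t, x)` with `t̂ - R² ≤ t < t̂`, `|x'| ≤ R`, `|x₃ - x̂₃| ≤ R` is a regular
point of `v` (clean past: `v` smooth on the slab below `t̂`) and (C2) every `x` with `|x'| ≤ R`,
`|x₃ - x̂₃| ≤ R` which is off the axis or has `|x₃ - h₊| < δ` or `|x₃ - h₋| < δ` is a backward
regular point `(t̂, x)` (smoothness on `supp ∇η` up to the top time for the Step-1 cut-off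
`η = φ(r)ψ(x₃)ξ(t)` at `(ẑ, R)`), then `v ∈ L_∞(Q(ẑ, r))` for some `r > 0` — this is what
Steps 2–4 establish on such a configuration. Then the origin is a regular point of `v`.
Proof: otherwise `(0, 0)` is backward singular (`isRegularAtOrigin_iff_backwardRegular_zero`),
`exists_firstSingular_configuration` produces a backward-SINGULAR `ẑ` with data satisfying
(C1)–(C2), and `hcore` makes it regular.
[cite: Seregin2022LocalAxisym, §2 proof of Thm. 1.2, Steps 1–4 (arXiv:2201.00153 pp. 5–7)] -/
theorem seregin2022_regularAtOrigin_of_forall_clean : ∀ (v : ℝ → EuclideanSpace ℝ (Fin 3) → EuclideanSpace ℝ (Fin 3)) (q : ℝ → EuclideanSpace ℝ (Fin 3) → ℝ), IsSuitableWeakSolutionOn (SereginSverak2009.parCylOpens 0 1) 1 0 v q → (∃ C : ℝ≥0, ∀ᵐ t ∂(volume.restrict (Ioo (-1 : ℝ) 0)), ∫⁻ x in SereginSverak2009.spaceCyl 0 1, ‖v t x‖ₑ ^ 2 ≤ C) → (∃ G : ℝ → EuclideanSpace ℝ (Fin 3) → EuclideanSpace ℝ (Fin 3) →L[ℝ] EuclideanSpace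 ℝ (Fin 3), HasWeakSpatialGradientOn (SereginSverak2009.parCylOpens 0 1) v G ∧ ∫⁻ z in SereginSverak2009.parCyl 0 1, ENNReal.ofReal (frobeniusNormSq (G z.1 z.2)) < ∞) → (∫⁻ z in SereginSverak2009.parCyl 0 1, ‖q z.1 z.2‖ₑ ^ (3 / 2 : ℝ) < ∞) → (∀ t ∈ Ioo (-1 : ℝ) 0, IsAxisymmetric (v t)) → (∀ t ∈ Ioo (-1 : ℝ) 0, IsAxisymmetricScalar (q t)) → (∃ C₁ : ℝ, ∀ t ∈ Ioo (-1 : ℝ) 0, ∀ x ∈ SereginSverak2009.spaceCyl 0 1, 0 < cylRadius x → |swirl (v t) x| ≤ C₁ / Real.log (Real.exp 1 / cylRadius x) ^ 3) → (∀ (zc : ℝ × EuclideanSpace ℝ (Fin 3)) (R hp hm δ : ℝ), zc.1 ∈ Ioc (-1 / 16 : ℝ) 0 → cylRadius zc.2 = 0 → |zc.2 2| ≤ 1 / 4 → 0 < R → R ≤ 1 / 4 → (∀ z : ℝ × EuclideanSpace ℝ (Fin 3), zc.1 - R ^ 2 ≤ z.1 → z.1 < zc.1 → cylRadius z.2 ≤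 R → |z.2 2 - zc.2 2| ≤ R → IsRegularPoint v z) → 0 < δ → zc.2 2 - R ≤ hm - δ → hm + δ < zc.2 2 → zc.2 2 < hp - δ → hp + δ ≤ zc.2 2 + R → (∀ x : EuclideanSpace ℝ (Fin 3), cylRadius x ≤ R → |x 2 - zc.2 2| ≤ R → (0 < cylRadius x ∨ |x 2 - hp| < δ ∨ |x 2 - hm| < δ) → ∃ r > 0, eLpNorm (uncurry v) ∞ (volume.restrict (parabolicCylinder r (zc.1, x))) < ∞) → ∃ r > 0, eLpNorm (uncurry v) ∞ (volume.restrict (parabolicCylinder r zc)) < ∞) → SereginSverak2009.IsRegularAtOrigin v := by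
  intro v q hsw hA hG hq hv_ax _hq_ax _hσ hcore
  obtain ⟨G, hG, hE⟩ := hG
  by_contra hnot
  have hsing : ¬ ∃ r > 0, eLpNorm (uncurry v) ∞
      (volume.restrict (parabolicCylinder r (0 : ℝ × EuclideanSpace ℝ (Fin 3)))) < ∞ :=
    fun h => hnot (isRegularAtOrigin_iff_backwardRegular_zero.2 h)
  obtain ⟨zc, R, hp, hm, δ, h1, h2, h3, h4, h5, hzc, hC1, h7, h8, h9, h10, h11, hC2⟩ :=
    exists_firstSingular_configuration v q G hsw hA hG hE hq hv_ax hsing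
  exact hzc (hcore zc R hp hm δ h1 h2 h3 h4 h5 hC1 h7 h8 h9 h10 h11 hC2)

/-- **Seregin 2022, §2: the criterion reduced to the core in classical form.** As
`seregin2022_regularAtOrigin_of_forall_clean`, with the core `hcoreV` receiving, instead of the
regularity primitives (C1)–(C2), their classical content (`exists_cleanSlab_repr`): a
representative `V` of `v` on the open slab `Q(ẑ, R) = 𝒞(x̂, R) × ]t̂ - R², t̂[` with `(V, q)` a
sufficiently smooth axially symmetric solution there (Seregin–Zajaczkowski 2007:
`IsSmoothAxisymmetricSolutionOn`), `v = V` a.e. on the slab, and, at every top-slice point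
`a ∈ 𝒞(x̂, R)` off the axis or with `|a₃ - h₊| < δ` or `|a₃ - h₋| < δ`, bounds `‖D_xⁿV‖ ≤ Cₙ`
on a backward cylinder `Q((t̂, a), ρ) ⊆ Q(ẑ, R)` (smoothness up to the top time on
`supp ∇η`). If every such configuration has `v ∈ L_∞(Q(ẑ, r))` for some `r > 0` (Steps 2–4),
the origin is a regular point of `v`.
[cite: Seregin2022LocalAxisym, §2 proof of Thm. 1.2, Steps 1–4 (arXiv:2201.00153 pp. 5–7)] -/
theorem seregin2022_regularAtOrigin_of_forall_cleanRepr : ∀ (v : ℝ → EuclideanSpace ℝ (Fin 3) → EuclideanSpace ℝ (Fin 3)) (q : ℝ → EuclideanSpace ℝ (Fin 3) → ℝ), IsSuitableWeakSolutionOn (SereginSverak2009.parCylOpens 0 1) 1 0 v q → (∃ C : ℝ≥0, ∀ᵐ t ∂(volume.restrict (Ioo (-1 : ℝ) 0)), ∫⁻ x in SereginSverak2009.spaceCyl 0 1, ‖v t x‖ₑ ^ 2 ≤ C) → (∃ G : ℝ → EuclideanSpace ℝ (Fin 3) → EuclideanSpace ℝ (Fin 3) →L[ℝ] EuclideanSpace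 ℝ (Fin 3), HasWeakSpatialGradientOn (SereginSverak2009.parCylOpens 0 1) v G ∧ ∫⁻ z in SereginSverak2009.parCyl 0 1, ENNReal.ofReal (frobeniusNormSq (G z.1 z.2)) < ∞) → (∫⁻ z in SereginSverak2009.parCyl 0 1, ‖q z.1 z.2‖ₑ ^ (3 / 2 : ℝ) < ∞) → (∀ t ∈ Ioo (-1 : ℝ) 0, IsAxisymmetric (v t)) → (∀ t ∈ Ioo (-1 : ℝ) 0, IsAxisymmetricScalar (q t)) → (∃ C₁ : ℝ, ∀ t ∈ Ioo (-1 : ℝ) 0, ∀ x ∈ SereginSverak2009.spaceCyl 0 1, 0 < cylRadius x → |swirl (v t) x| ≤ C₁ / Real.log (Real.exp 1 / cylRadius x) ^ 3) → (∀ (zc : ℝ × EuclideanSpace ℝ (Fin 3)) (R hp hm δ : ℝ) (V : ℝ → EuclideanSpace ℝ (Fin 3) → EuclideanSpace ℝ (Fin 3)), zc.1 ∈ Ioc (-1 / 16 : ℝ) 0 → cylRadius zc.2 = 0 → |zc.2 2| ≤ 1 / 4 → 0 < R → R ≤ 1 / 4 → SereginZajaczkowski2007.IsSmoothAxisymmetricSolutionOn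 (SereginSverak2009.parCylOpens zc R) V q → uncurry v =ᵐ[volume.restrict (SereginSverak2009.parCyl zc R)] uncurry V → 0 < δ → zc.2 2 - R ≤ hm - δ → hm + δ < zc.2 2 → zc.2 2 < hp - δ → hp + δ ≤ zc.2 2 + R → (∀ a ∈ SereginSverak2009.spaceCyl zc.2 R, (0 < cylRadius a ∨ |a 2 - hp| < δ ∨ |a 2 - hm| < δ) → ∃ ρ > 0, parabolicCylinder ρ ((zc.1, a) : ℝ × EuclideanSpace ℝ (Fin 3)) ⊆ SereginSverak2009.parCyl zc R ∧ ∀ n : ℕ, ∃ C : ℝ, ∀ w ∈ parabolicCylinder ρ ((zc.1, a) : ℝ × EuclideanSpace ℝ (Fin 3)), ‖iteratedFDeriv ℝ n (V w.1) w.2‖ ≤ C) → ∃ r > 0, eLpNorm (uncurry v) ∞ (volume.restrict (parabolicCylinder r zc)) < ∞) → SereginSverak2009.IsRegularAtOrigin v := by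
  intro v q hsw hA hG hq hv_ax hq_ax hσ hcoreV
  refine seregin2022_regularAtOrigin_of_forall_clean v q hsw hA hG hq hv_ax hq_ax hσ ?_
  intro zc R hp hm δ h1 h2 h3 h4 h5 hC1 h7 h8 h9 h10 h11 hC2
  obtain ⟨V, hV, hae, hbd⟩ := exists_cleanSlab_repr v q hsw hq hv_ax zc R h1 h2 h3 h4 h5 hC1
  refine hcoreV zc R hp hm δ V h1 h2 h3 h4 h5 hV hae h7 h8 h9 h10 h11 fun a ha hdisj => ?_
  rw [mem_spaceCyl, cylRadius_sub_of_cylRadius_eq_zero h2] at ha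
  exact hbd a (by rwa [mem_spaceCyl, cylRadius_sub_of_cylRadius_eq_zero h2])
    (hC2 a ha.1.le ha.2.le hdisj)

/-- **The named fact from the classical core.** If the core step holds for every `(v, q)` of the
class (H) — the statement Steps 2–4 of the printed proof establish on the Step-1 configuration
(C1)–(C2) around an axis point — then `seregin2022_logSwirl_regularAtOrigin` holds: the fact IS
`∀ v q, (H) → IsRegularAtOrigin v`, and `seregin2022_regularAtOrigin_of_forall_clean` supplies it
from the core at `(v, q)`.
[cite: Seregin2022LocalAxisym, §2 proof of Thm. 1.2, Steps 1–4 (arXiv:2201.00153 pp. 5–7)] -/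
theorem seregin2022_logSwirl_regularAtOrigin_of_cleanCore
    (core : ∀ (v : ℝ → EuclideanSpace ℝ (Fin 3) → EuclideanSpace ℝ (Fin 3))
      (q : ℝ → EuclideanSpace ℝ (Fin 3) → ℝ),
      IsSuitableWeakSolutionOn (SereginSverak2009.parCylOpens 0 1) 1 0 v q →
      (∃ C : ℝ≥0, ∀ᵐ t ∂(volume.restrict (Ioo (-1 : ℝ) 0)),
        ∫⁻ x in SereginSverak2009.spaceCyl 0 1, ‖v t x‖ₑ ^ 2 ≤ C) →
      (∃ G : ℝ → EuclideanSpace ℝ (Fin 3) → EuclideanSpace ℝ (Fin 3) →L[ℝ] EuclideanSpace ℝ (Fin 3),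
        HasWeakSpatialGradientOn (SereginSverak2009.parCylOpens 0 1) v G ∧
          ∫⁻ z in SereginSverak2009.parCyl 0 1, ENNReal.ofReal (frobeniusNormSq (G z.1 z.2)) < ∞) →
      (∫⁻ z in SereginSverak2009.parCyl 0 1, ‖q z.1 z.2‖ₑ ^ (3 / 2 : ℝ) < ∞) →
      (∀ t ∈ Ioo (-1 : ℝ) 0, IsAxisymmetric (v t)) →
      (∀ t ∈ Ioo (-1 : ℝ) 0, IsAxisymmetricScalar (q t)) →
      (∃ C₁ : ℝ, ∀ t ∈ Ioo (-1 : ℝ) 0, ∀ x ∈ SereginSverak2009.spaceCyl 0 1, 0 < cylRadius x →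
        |swirl (v t) x| ≤ C₁ / Real.log (Real.exp 1 / cylRadius x) ^ 3) →
      ∀ (zc : ℝ × EuclideanSpace ℝ (Fin 3)) (R hp hm δ : ℝ), zc.1 ∈ Ioc (-1 / 16 : ℝ) 0 →
        cylRadius zc.2 = 0 → |zc.2 2| ≤ 1 / 4 → 0 < R → R ≤ 1 / 4 →
        (∀ z : ℝ × EuclideanSpace ℝ (Fin 3), zc.1 - R ^ 2 ≤ z.1 → z.1 < zc.1 →
          cylRadius z.2 ≤ R → |z.2 2 - zc.2 2| ≤ R → IsRegularPoint v z) →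
        0 < δ → zc.2 2 - R ≤ hm - δ → hm + δ < zc.2 2 → zc.2 2 < hp - δ → hp + δ ≤ zc.2 2 + R →
        (∀ x : EuclideanSpace ℝ (Fin 3), cylRadius x ≤ R → |x 2 - zc.2 2| ≤ R →
          (0 < cylRadius x ∨ |x 2 - hp| < δ ∨ |x 2 - hm| < δ) →
          ∃ r > 0, eLpNorm (uncurry v) ∞
            (volume.restrict (parabolicCylinder r ((zc.1, x) : ℝ × EuclideanSpace ℝ (Fin 3)))) < ∞) →
        ∃ r > 0, eLpNorm (uncurry v) ∞ (volume.restrict (parabolicCylinder r zc)) < ∞) :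
    seregin2022_logSwirl_regularAtOrigin :=
  fun v q hsw hA hG hq hv_ax hq_ax hσ =>
    seregin2022_regularAtOrigin_of_forall_clean v q hsw hA hG hq hv_ax hq_ax hσ
      (core v q hsw hA hG hq hv_ax hq_ax hσ)

/-- **The named fact from the core in classical form** (`seregin2022_regularAtOrigin_of_forall_cleanRepr`
with the core quantified over the class (H)): Steps 2–4 of the printed proof, run for the
Seregin–Zajaczkowski representative on the clean slab with derivative bounds up to the top time
on `supp ∇η`, give the fact. [cite: Seregin2022LocalAxisym, §2 proof of Thm. 1.2, Steps 1–4 (arXiv:2201.00153 pp. 5–7)] -/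
theorem seregin2022_logSwirl_regularAtOrigin_of_cleanRepr
    (core : ∀ (v : ℝ → EuclideanSpace ℝ (Fin 3) → EuclideanSpace ℝ (Fin 3))
      (q : ℝ → EuclideanSpace ℝ (Fin 3) → ℝ),
      IsSuitableWeakSolutionOn (SereginSverak2009.parCylOpens 0 1) 1 0 v q →
      (∃ C : ℝ≥0, ∀ᵐ t ∂(volume.restrict (Ioo (-1 : ℝ) 0)),
        ∫⁻ x in SereginSverak2009.spaceCyl 0 1, ‖v t x‖ₑ ^ 2 ≤ C) →
      (∃ G : ℝ → EuclideanSpace ℝ (Fin 3) → EuclideanSpace ℝ (Fin 3) →L[ℝ] EuclideanSpace ℝ (Fin 3),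
        HasWeakSpatialGradientOn (SereginSverak2009.parCylOpens 0 1) v G ∧
          ∫⁻ z in SereginSverak2009.parCyl 0 1, ENNReal.ofReal (frobeniusNormSq (G z.1 z.2)) < ∞) →
      (∫⁻ z in SereginSverak2009.parCyl 0 1, ‖q z.1 z.2‖ₑ ^ (3 / 2 : ℝ) < ∞) →
      (∀ t ∈ Ioo (-1 : ℝ) 0, IsAxisymmetric (v t)) →
      (∀ t ∈ Ioo (-1 : ℝ) 0, IsAxisymmetricScalar (q t)) →
      (∃ C₁ : ℝ, ∀ t ∈ Ioo (-1 : ℝ) 0, ∀ x ∈ SereginSverak2009.spaceCyl 0 1, 0 < cylRadius x →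
        |swirl (v t) x| ≤ C₁ / Real.log (Real.exp 1 / cylRadius x) ^ 3) →
      ∀ (zc : ℝ × EuclideanSpace ℝ (Fin 3)) (R hp hm δ : ℝ)
        (V : ℝ → EuclideanSpace ℝ (Fin 3) → EuclideanSpace ℝ (Fin 3)),
        zc.1 ∈ Ioc (-1 / 16 : ℝ) 0 → cylRadius zc.2 = 0 → |zc.2 2| ≤ 1 / 4 → 0 < R → R ≤ 1 / 4 →
        IsSmoothAxisymmetricSolutionOn (SereginSverak2009.parCylOpens zc R) V q →
        uncurry v =ᵐ[volume.restrict (SereginSverak2009.parCyl zc R)] uncurry V →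
        0 < δ → zc.2 2 - R ≤ hm - δ → hm + δ < zc.2 2 → zc.2 2 < hp - δ → hp + δ ≤ zc.2 2 + R →
        (∀ a ∈ SereginSverak2009.spaceCyl zc.2 R, (0 < cylRadius a ∨ |a 2 - hp| < δ ∨ |a 2 - hm| < δ) →
          ∃ ρ > 0, parabolicCylinder ρ ((zc.1, a) : ℝ × EuclideanSpace ℝ (Fin 3)) ⊆
              SereginSverak2009.parCyl zc R ∧
            ∀ n : ℕ, ∃ C : ℝ, ∀ w ∈ parabolicCylinder ρ ((zc.1, a) : ℝ × EuclideanSpace ℝ (Fin 3)),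
              ‖iteratedFDeriv ℝ n (V w.1) w.2‖ ≤ C) →
        ∃ r > 0, eLpNorm (uncurry v) ∞ (volume.restrict (parabolicCylinder r zc)) < ∞) :
    seregin2022_logSwirl_regularAtOrigin :=
  fun v q hsw hA hG hq hv_ax hq_ax hσ =>
    seregin2022_regularAtOrigin_of_forall_cleanRepr v q hsw hA hG hq hv_ax hq_ax hσ
      (core v q hsw hA hG hq hv_ax hq_ax hσ)

end Summit.NavierStokesRegularity.NavierStokesRegularity.Theorems.AxisymmetricKatoGlobal.EulerScaling

end
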